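import Literature.AlgebraicGeometry.Modules.SheafHomLeft
import Literature.AlgebraicGeometry.Modules.SheafHomExact
import Literature.AlgebraicGeometry.Modules.LocalExactness
import HarnessLib

/-!
# `𝓗om_{𝒪_X}(–, F)` is exact on short exact sequences with finite locally free cokernel

For an `𝒪_X`-module `F` on a scheme `X` the contravariant internal Hom `E ↦ 𝓗om(E, F)`
(`Modules/SheafHomLeft.lean`: `sheafHomMapLeft φ F : 𝓗om(E₂, F) ⟶ 𝓗om(E₁, F)` for `φ : E₁ ⟶ E₂`)
takes a short exact sequence `S : 0 → E₁ →f E₂ →g E₃ → 0` to the complex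

  `𝓗om(S, F) : 𝓗om(E₃, F) ⟶ 𝓗om(E₂, F) ⟶ 𝓗om(E₁, F)` (`sheafHomLeftShortComplex`),

which is always LEFT exact (`mono_sheafHomMapLeft_of_epi`, `sheafHomLeftShortComplex_exact`: a
morphism `E₂|_U → F|_U` killing `E₁|_U` factors uniquely through the cokernel `E₃|_U`, restriction
to the opens over `U` being exact), and SHORT exact as soon as `E₃` is finite locally free
(`epi_sheafHomMapLeft_of_isFiniteLocallyFree`, `shortExact_sheafHomLeft`): then `S` is locally
split — near every point a local basis of `E₃` lifts through the epimorphism `g`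
(`Modules/SheafHomExact.lean`, `exists_restrictHom_eq_comp`), giving a local section `σ` of `g`
and the local retraction `r = f⁻¹ ∘ (𝟙 − g σ)` of `f` — so every `θ : E₁|_U → F|_U` extends locally
to `r ≫ θ : E₂|_W → F|_W`, i.e. `𝓗om(f, F)` is locally surjective, hence an epimorphism (Mathlib
`TopCat.Sheaf.isLocallySurjective_iff_epi`). This is the sheaf form of the fact that `Hom(–, F)`
is exact on split short exact sequences (Hartshorne III.6, proof of Prop. 6.7 ∕ II Ex. 5.1: for
`L` locally free of finite rank the functors built from `𝓗om` and `⊗ L^∨` are exact); it is used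
(venture `HSemireg`, cell `pub-hsemireg`, seat s4-prove-1 g28, 2026-08-28) to turn an extension
`κ : 0 → 𝒯 → 𝒦 → 𝒪_X → 0` (a class in `H¹(X, 𝒯) = Ext¹(𝒪_X, 𝒯)`) into the functorial short
exact sequences `0 → 𝓗om(𝒪_X, F) → 𝓗om(𝒦, F) → 𝓗om(𝒯, F) → 0`, whose classes are the
contractions `κ ∪ –` of the Atiyah-class calculus (NOT in this file).

Everything is proved; no named facts, no instance, no notation.

## References

* R. Hartshorne, *Algebraic Geometry*, GTM 52 (1977): II Ex. 5.1 (b)–(c) (p. 123), III.6 proof of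
  Prop. 6.7 (p. 234). [Hartshorne1977]
* The Stacks project, Tag 01CM (Modules: internal Hom). [StacksProject]
-/

noncomputable section

open CategoryTheory AlgebraicGeometry Opposite TopologicalSpace Limits

namespace Literature.AlgebraicGeometry.Modules

open Literature.AlgebraicGeometry.Motives

universe u

variable {X : Scheme.{u}} {S : ShortComplex X.Modules} (F : X.Modules)

/-- A morphism of `𝒪_X`-modules which is injective on all sections is a monomorphism (local copy of
the library lemma, to keep the imports small). [folklore] -/
private lemma mono_of_injective_app' {A B : X.Modules} (f : A ⟶ B)
    (h : ∀ V, Function.Injective (f.app V)) : Mono f := by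
  haveI : ∀ V, Mono (f.mapPresheaf.app V) := fun V =>
    ConcreteCategory.mono_of_injective _ (h V.unop)
  haveI : Mono f.mapPresheaf := NatTrans.mono_of_mono_app _
  exact (Scheme.Modules.toPresheaf X).mono_of_mono_map this

/-- Restriction to the opens over `U` preserves epimorphisms (it is exact). [folklore] -/
private lemma epi_overFunctor_map {E₂ E₃ : X.Modules} (g : E₂ ⟶ E₃) [Epi g] (U : X.Opens) :
    Epi ((SheafOfModules.overFunctor _ U).map g) := by
  have : Epi (ShortComplex.kernelSequence g).g := (inferInstance : Epi g)
  have hK : (ShortComplex.kernelSequence g).ShortExact :=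
    ShortComplex.ShortExact.mk' (ShortComplex.kernelSequence_exact g) inferInstance this
  exact (Scheme.Modules.shortExact_map_overFunctor hK U).epi_g

variable (S) in
/-- **`𝓗om(S, F)`**: the complex `𝓗om(E₃, F) ⟶ 𝓗om(E₂, F) ⟶ 𝓗om(E₁, F)` obtained by applying the
contravariant internal Hom `𝓗om(–, F)` to a short complex `S : E₁ → E₂ → E₃`.
[cite: StacksProject, Tag 01CM] -/
def sheafHomLeftShortComplex : ShortComplex X.Modules :=
  ShortComplex.mk (sheafHomMapLeft S.g F) (sheafHomMapLeft S.f F)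
    (by rw [← sheafHomMapLeft_comp, S.zero, sheafHomMapLeft_zero])

/-- `𝓗om(g, F)` is a monomorphism when `g` is an epimorphism (`ψ ↦ g|_U ≫ ψ` is injective because
`g|_U` is an epimorphism, restriction being exact). [cite: StacksProject, Tag 01CM] -/
theorem mono_sheafHomMapLeft_of_epi {E₂ E₃ : X.Modules} (g : E₂ ⟶ E₃) [Epi g] :
    Mono (sheafHomMapLeft g F) := by
  refine mono_of_injective_app' _ fun U ψ ψ' h => ?_
  have := epi_overFunctor_map g U
  exact (cancel_epi ((SheafOfModules.overFunctor _ U).map g)).mp h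

/-- **Left exactness of `𝓗om(–, F)`**: for `S` short exact, `𝓗om(E₃, F) → 𝓗om(E₂, F) → 𝓗om(E₁, F)`
is exact at `𝓗om(E₂, F)` — a morphism `ψ : E₂|_U → F|_U` with `f|_U ≫ ψ = 0` factors through the
cokernel `g|_U : E₂|_U → E₃|_U` (the restricted sequence is short exact). [cite: StacksProject, Tag 01CM] -/
theorem sheafHomLeftShortComplex_exact (hS : S.ShortExact) :
    (sheafHomLeftShortComplex S F).Exact := by
  refine exact_of_locally_exact _ fun V (ψ : S.X₂.over V ⟶ F.over V)
    (hψ : (SheafOfModules.overFunctor _ V).map S.f ≫ ψ = 0) x hx => ⟨V, 𝟙 V, hx, ?_⟩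
  have hSV := Scheme.Modules.shortExact_map_overFunctor hS V
  have := hSV.epi_g
  refine ⟨(hSV.exact.desc ψ hψ : S.X₃.over V ⟶ F.over V), ?_⟩
  have e1 : (sheafHom S.X₂ F).presheaf.map (𝟙 V).op ψ = ψ := by
    rw [op_id, CategoryTheory.Functor.map_id]
    rfl
  exact (hSV.exact.g_desc ψ hψ).trans e1.symm

/-- **`𝓗om(f, F)` is an epimorphism when the cokernel `E₃` of `f` is finite locally free**: `S` is
then locally split, so every `θ : E₁|_U → F|_U` extends locally along `f` (`𝓗om(f, F)` is locally
surjective). [cite: Hartshorne1977, III.6 (proof of Prop. 6.7) and II Ex. 5.1 (b)] -/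
theorem epi_sheafHomMapLeft_of_isFiniteLocallyFree (hS : S.ShortExact)
    (h₃ : IsFiniteLocallyFree S.X₃) : Epi (sheafHomMapLeft S.f F) := by
  have := hS.epi_g
  have hls : TopCat.Presheaf.IsLocallySurjective (sheafHomMapLeft S.f F).mapPresheaf := by
    rw [TopCat.Presheaf.isLocallySurjective_iff]
    intro U θ x hx
    -- a local section `σ` of `g` near `x` (lift a local basis of the finite locally free `E₃`)
    obtain ⟨W, k, hxW, σ, hσ⟩ :=
      exists_restrictHom_eq_comp h₃ S.g (𝟙 (S.X₃.over U)) x hx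
    rw [restrictHom_id] at hσ
    -- the restricted sequence `S' = S|_W` is short exact; work with its objects
    have hSW := Scheme.Modules.shortExact_map_overFunctor hS W
    have := hSW.mono_f
    let σ' : (S.map (Scheme.Modules.overFunctor W)).X₃ ⟶ (S.map (Scheme.Modules.overFunctor W)).X₂ := σ
    have hσ' : σ' ≫ (S.map (Scheme.Modules.overFunctor W)).g = 𝟙 _ := hσ
    -- `r := f⁻¹ ∘ (𝟙 − g σ)` is a retraction of `f|_W`
    have h0 : (𝟙 _ - (S.map (Scheme.Modules.overFunctor W)).g ≫ σ') ≫
        (S.map (Scheme.Modules.overFunctor W)).g = 0 := by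
      rw [Preadditive.sub_comp, Category.id_comp, Category.assoc, hσ', Category.comp_id, sub_self]
    have hl := hSW.exact.lift_f _ h0
    have hr : (S.map (Scheme.Modules.overFunctor W)).f ≫ hSW.exact.lift _ h0 = 𝟙 _ := by
      rw [← cancel_mono (S.map (Scheme.Modules.overFunctor W)).f, Category.assoc, hl,
        Preadditive.comp_sub, Category.comp_id, (S.map (Scheme.Modules.overFunctor W)).zero_assoc,
        zero_comp, sub_zero, Category.id_comp]
    let χ : S.X₂.over W ⟶ F.over W :=
      (hSW.exact.lift _ h0 : S.X₂.over W ⟶ S.X₁.over W) ≫ restrictHom k θ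
    refine ⟨W, k.le, ⟨χ, ?_⟩, hxW⟩
    change (Scheme.Modules.overFunctor W).map S.f ≫ χ = restrictHom k θ
    exact ((Category.assoc _ _ _).symm.trans (congrArg (· ≫ restrictHom k θ) hr)).trans
      (Category.id_comp _)
  have h1 : Epi ((SheafOfModules.toSheaf X.ringCatSheaf).map (sheafHomMapLeft S.f F)) :=
    (TopCat.Sheaf.isLocallySurjective_iff_epi _).mp hls
  exact (SheafOfModules.toSheaf X.ringCatSheaf).epi_of_epi_map h1

/-- **`𝓗om(–, F)` is exact on short exact sequences with finite locally free cokernel**: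
`0 → 𝓗om(E₃, F) → 𝓗om(E₂, F) → 𝓗om(E₁, F) → 0` is short exact for `S : 0 → E₁ → E₂ → E₃ → 0`
short exact with `E₃` finite locally free (locally split). [cite: Hartshorne1977, III.6 (proof of Prop. 6.7) and II Ex. 5.1 (b)] -/
theorem shortExact_sheafHomLeft (hS : S.ShortExact) (h₃ : IsFiniteLocallyFree S.X₃) :
    (sheafHomLeftShortComplex S F).ShortExact :=
  have := hS.epi_g
  ShortComplex.ShortExact.mk' (sheafHomLeftShortComplex_exact F hS)
    (mono_sheafHomMapLeft_of_epi F S.g) (epi_sheafHomMapLeft_of_isFiniteLocallyFree F hS h₃)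

/-- `𝓗om(S, F)` is natural in `F`: a morphism `u : F → F'` induces a morphism of complexes
`𝓗om(S, F) → 𝓗om(S, F')` (post-composition commutes with pre-composition). [cite: StacksProject, Tag 01CM] -/
def sheafHomLeftShortComplexMap {F F' : X.Modules} (u : F ⟶ F') :
    sheafHomLeftShortComplex S F ⟶ sheafHomLeftShortComplex S F' :=
  ShortComplex.homMk (sheafHomMap S.X₃ u) (sheafHomMap S.X₂ u) (sheafHomMap S.X₁ u)
    (sheafHomMapLeft_sheafHomMap F' S.g u).symm (sheafHomMapLeft_sheafHomMap F' S.f u).symm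

/-- `𝓗om(S, –)` on morphisms respects composition (bifunctoriality of the internal Hom).
[cite: StacksProject, Tag 01CM] -/
theorem sheafHomLeftShortComplexMap_comp {F F' F'' : X.Modules} (u : F ⟶ F') (v : F' ⟶ F'') :
    sheafHomLeftShortComplexMap (S := S) (u ≫ v) =
      sheafHomLeftShortComplexMap u ≫ sheafHomLeftShortComplexMap v :=
  ShortComplex.hom_ext _ _ (sheafHomMap_comp _ u v) (sheafHomMap_comp _ u v) (sheafHomMap_comp _ u v)

/-- `𝓗om(S, –)` on morphisms kills `0` (the internal Hom is additive in the second variable).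
[cite: StacksProject, Tag 01CM] -/
theorem sheafHomLeftShortComplexMap_zero {F F' : X.Modules} :
    sheafHomLeftShortComplexMap (S := S) (0 : F ⟶ F') = 0 :=
  ShortComplex.hom_ext _ _ ((sheafHomFunctor S.X₃).map_zero F F')
    ((sheafHomFunctor S.X₂).map_zero F F') ((sheafHomFunctor S.X₁).map_zero F F')

end Literature.AlgebraicGeometry.Modules

end
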